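import Summits.ValiantsHypothesis.ValiantsHypothesis.Theorems.KPlusLogSqLawTropicalBMarkedEdgeCoreHeight

/-!
# Route «KPlusLogSqLaw», crux `TropicalB` (stmt-ValiantsHypothesis-19771) — MARKED-EDGE sector, NESTED-TRIANGLE CORE, ALL sizes, part 7:
# b4-RIGIDITY IN THE FOUR-UNION — a cover using the loop at `b4` but not at `b0` never uses the loop at `b3`

HONEST FRAMING.  Helper file (cell `pub-symmetroid`, seat val-sym-trop-p4 (g18), 2026-08-28; `--supports stmt-ValiantsHypothesis-19771 --as
helper`).  Continues parts 1–6 (… `…CoreFour` = the three-union version, `…CoreHeight` = four-body Z-rigidity).  In the located residual menu of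
Karamata certificates (memo ALLM-STRUCTURE-g18.md §3) the top factor is a «Q-cover» of pattern {b1,b4} or {b2,b4}, possibly using arcs of all four
covers (templates (c)); this part records the four-union half of why no Q-cover ever carries `b3`: with `T b4 = b4`, `T b0 ≠ b0`, `T b3 = b3` inside
`σB ⊎ σC ⊎ σE ⊎ σZ`, complete `T` by `three_factor`; the loop at `b3` is left exactly once, so one completing factor has slope ≥ 8 and the other two,
confined to the loops `b0, b1, b2` with `b0` available once, cannot both reach 7 — `four_factors_eq` then forces `T = σZ`, absurd.  Nothing here proves
the law; nothing concerns `TropicalB` in its window, `WeakLifting`, the doors, `MatrixDescartes` (stmt-ValiantsHypothesis-18050) or VP ≠ VNP.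
-/

set_option linter.dupNamespace false
set_option autoImplicit false

namespace Summit.ValiantsHypothesis.ValiantsHypothesis.Theorems.KPlusLogSqLaw
namespace MarkedEdge
namespace Core

open Finset

variable {V : Type*} [Fintype V] [DecidableEq V]

omit [Fintype V] in
/-- multiplicity ≤ 1 among four: at most one of `x, y, z` equals `v`. [folklore] -/
theorem pairs4_of_count_le_one {t x y z v : V} {l : List V} (h : List.Perm [t, x, y, z] l) (hc : l.count v ≤ 1) :
    (x = v → y ≠ v ∧ z ≠ v) ∧ (y = v → z ≠ v) := by
  have hc' := h.count_eq v
  by_cases ht : t = v <;> by_cases hx : x = v <;> by_cases hy : y = v <;> by_cases hz : z = v <;>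
    simp [ht, hx, hy, hz] at hc' ⊢ <;> omega

omit [Fintype V] in
/-- multiplicity 2 among four with the head equal to `v`: exactly one of `x, y, z` equals `v`. [folklore] -/
theorem one_of_three_of_count_two {t x y z v : V} {l : List V} (h : List.Perm [t, x, y, z] l) (hc : l.count v = 2) (ht : t = v) :
    (x = v ∧ y ≠ v ∧ z ≠ v) ∨ (x ≠ v ∧ y = v ∧ z ≠ v) ∨ (x ≠ v ∧ y ≠ v ∧ z = v) := by
  have hc' := h.count_eq v
  rw [hc] at hc'
  subst ht
  by_cases hx : x = t <;> by_cases hy : y = t <;> by_cases hz : z = t <;> simp [hx, hy, hz] at hc' ⊢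

section Core

variable (ok : V → V → Prop) (w g : V → V → ℤ) (b : Fin 5 → V)

/-- a cover using the loops at `b3` and `b4` has slope at least 24. [folklore] -/
theorem twentyfour_le_slope (hb : Function.Injective b)
    (hoff : ∀ i j, j ≠ i → g i j = 0) (hmark : ∀ l, g (b l) (b l) = (2 : ℤ) ^ (l : ℕ)) (haux : ∀ i, (∀ l, b l ≠ i) → g i i = 0)
    (T : Equiv.Perm V) (hT3 : T (b 3) = b 3) (hT4 : T (b 4) = b 4) : 24 ≤ ∑ i, g i (T i) := by
  rw [slope_eq_sum_marked g b hb hoff hmark haux T, Fin.sum_univ_five]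
  by_cases c0 : T (b 0) = b 0 <;> by_cases c1 : T (b 1) = b 1 <;> by_cases c2 : T (b 2) = b 2 <;>
    simp [hT3, hT4, c0, c1, c2]

/-- a cover using the loop at `b3` has slope at least 8. [folklore] -/
theorem eight_le_slope (hb : Function.Injective b)
    (hoff : ∀ i j, j ≠ i → g i j = 0) (hmark : ∀ l, g (b l) (b l) = (2 : ℤ) ^ (l : ℕ)) (haux : ∀ i, (∀ l, b l ≠ i) → g i i = 0)
    (M : Equiv.Perm V) (hM3 : M (b 3) = b 3) : 8 ≤ ∑ i, g i (M i) := by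
  rw [slope_eq_sum_marked g b hb hoff hmark haux M, Fin.sum_univ_five]
  by_cases c0 : M (b 0) = b 0 <;> by_cases c1 : M (b 1) = b 1 <;> by_cases c2 : M (b 2) = b 2 <;> by_cases c4 : M (b 4) = b 4 <;>
    simp [hM3, c0, c1, c2, c4]

/-- a cover missing the loops at `b0`, `b3`, `b4`... restated with `b0` allowed: missing `b3, b4` and `b0` gives slope ≤ 6; missing `b3, b4` with slope
above 6 forces the loop at `b0`. [folklore] -/
theorem fix_zero_of_gt_six (hb : Function.Injective b)
    (hoff : ∀ i j, j ≠ i → g i j = 0) (hmark : ∀ l, g (b l) (b l) = (2 : ℤ) ^ (l : ℕ)) (haux : ∀ i, (∀ l, b l ≠ i) → g i i = 0)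
    (M : Equiv.Perm V) (hM3 : M (b 3) ≠ b 3) (hM4 : M (b 4) ≠ b 4) (hs : 6 < ∑ i, g i (M i)) : M (b 0) = b 0 := by
  rcases shape_of_slope_gt_six g b hb hoff hmark haux M hM4 hs with h | ⟨h0, -, -⟩
  exacts [absurd h hM3, h0]

/-- **b4-RIGIDITY in the four-union.**  In any realisation of the core (any finite `V`), a cover inside the arcs of `σB, σC, σE, σZ` that uses the
loop at `b4` but not the loop at `b0` does not use the loop at `b3`. [this seat's lemma] -/
theorem core_BCEZ_four_three (hb : Function.Injective b)
    (hoff : ∀ i j, j ≠ i → g i j = 0) (hmark : ∀ l, g (b l) (b l) = (2 : ℤ) ^ (l : ℕ)) (haux : ∀ i, (∀ l, b l ≠ i) → g i i = 0)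
    {θB θC θE θZ : ℤ} {σB σC σE σZ : Equiv.Perm V} (hBC : θB < θC) (hCE : θC < θE) (hEZ : θE < θZ)
    (hB : (∀ i, ok i (σB i)) ∧ ∀ τ : Equiv.Perm V, τ ≠ σB → (∀ i, ok i (τ i)) →
      ∑ i, (w i (τ i) + θB * g i (τ i)) < ∑ i, (w i (σB i) + θB * g i (σB i)))
    (hC : (∀ i, ok i (σC i)) ∧ ∀ τ : Equiv.Perm V, τ ≠ σC → (∀ i, ok i (τ i)) →
      ∑ i, (w i (τ i) + θC * g i (τ i)) < ∑ i, (w i (σC i) + θC * g i (σC i)))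
    (hE : (∀ i, ok i (σE i)) ∧ ∀ τ : Equiv.Perm V, τ ≠ σE → (∀ i, ok i (τ i)) →
      ∑ i, (w i (τ i) + θE * g i (τ i)) < ∑ i, (w i (σE i) + θE * g i (σE i)))
    (hZ : (∀ i, ok i (σZ i)) ∧ ∀ τ : Equiv.Perm V, τ ≠ σZ → (∀ i, ok i (τ i)) →
      ∑ i, (w i (τ i) + θZ * g i (τ i)) < ∑ i, (w i (σZ i) + θZ * g i (σZ i)))
    (hB0 : σB (b 0) ≠ b 0) (hB1 : σB (b 1) = b 1) (hB2 : σB (b 2) = b 2) (hB3 : σB (b 3) ≠ b 3) (hB4 : σB (b 4) ≠ b 4)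
    (hC0 : σC (b 0) ≠ b 0) (hC1 : σC (b 1) = b 1) (hC2 : σC (b 2) ≠ b 2) (hC3 : σC (b 3) = b 3) (hC4 : σC (b 4) ≠ b 4)
    (hE0 : σE (b 0) ≠ b 0) (hE1 : σE (b 1) ≠ b 1) (hE2 : σE (b 2) = b 2) (hE3 : σE (b 3) = b 3) (hE4 : σE (b 4) ≠ b 4)
    (hZ0 : σZ (b 0) = b 0) (hZ1 : σZ (b 1) ≠ b 1) (hZ2 : σZ (b 2) ≠ b 2) (hZ3 : σZ (b 3) ≠ b 3) (hZ4 : σZ (b 4) = b 4)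
    (T : Equiv.Perm V) (hT : ∀ i, T i = σB i ∨ T i = σC i ∨ T i = σE i ∨ T i = σZ i) (hT4 : T (b 4) = b 4) (hT0 : T (b 0) ≠ b 0) :
    T (b 3) ≠ b 3 := by
  intro hT3
  obtain ⟨M₂, M₃, M₄, hP⟩ := three_factor σB σC σE σZ T hT
  have sB := slope_B g b hb hoff hmark haux σB hB0 hB1 hB2 hB3 hB4
  have sC := slope_C g b hb hoff hmark haux σC hC0 hC1 hC2 hC3 hC4
  have sE := slope_E g b hb hoff hmark haux σE hE0 hE1 hE2 hE3 hE4
  have sZ := slope_Z g b hb hoff hmark haux σZ hZ0 hZ1 hZ2 hZ3 hZ4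
  have sT := twentyfour_le_slope g b hb hoff hmark haux T hT3 hT4
  have hsum := FourBit.sum_eq_of_factorisation₄ g hP
  rw [sB, sC, sE, sZ] at hsum
  obtain ⟨n24, n34, n44⟩ := excl4_of_count_le_one (v := b 4) (hP (b 4)) (by simp [hB4, hC4, hE4, hZ4]) hT4
  have x0 := pairs4_of_count_le_one (v := b 0) (hP (b 0)) (by simp [hB0, hC0, hE0, hZ0])
  have x3 := one_of_three_of_count_two (v := b 3) (hP (b 3)) (by simp [hB3, hC3, hE3, hZ3]) hT3
  have hhi4 : (∑ i, g i (σZ i)) ≤ ∑ i, g i (T i) := by rw [sZ]; omega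
  -- the two factors without `b3` cannot both exceed 6 (both would need the loop at `b0`)
  have two_low : ∀ {P Q : Equiv.Perm V}, P (b 3) ≠ b 3 → P (b 4) ≠ b 4 → Q (b 3) ≠ b 3 → Q (b 4) ≠ b 4 → (P (b 0) = b 0 → Q (b 0) ≠ b 0) →
      (∑ i, g i (P i)) ≤ 6 ∨ (∑ i, g i (Q i)) ≤ 6 := by
    intro P Q p3 p4 q3 q4 hpq
    by_contra hcon
    push Not at hcon
    exact hpq (fix_zero_of_gt_six g b hb hoff hmark haux P p3 p4 hcon.1) (fix_zero_of_gt_six g b hb hoff hmark haux Q q3 q4 hcon.2)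
  -- rigidity with `F₃` = the factor carrying `b3`, `F₁` = the low one, `F₄ = T`
  have key : ∀ {F₁ F₂ F₃ : Equiv.Perm V}, (∀ i, List.Perm [F₁ i, F₂ i, F₃ i, T i] [σB i, σC i, σE i, σZ i]) →
      (∑ i, g i (F₁ i)) ≤ 6 → 8 ≤ (∑ i, g i (F₃ i)) →
      (∑ i, g i (F₁ i)) + (∑ i, g i (F₂ i)) + (∑ i, g i (F₃ i)) + (∑ i, g i (T i)) = 6 + 10 + 12 + 17 → False := by
    intro F₁ F₂ F₃ hP' h1 h3 hs
    have hs34 : (∑ i, g i (σE i)) + (∑ i, g i (σZ i)) ≤ (∑ i, g i (F₃ i)) + ∑ i, g i (T i) := by rw [sE, sZ]; omega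
    have hs234 : (∑ i, g i (σC i)) + (∑ i, g i (σE i)) + (∑ i, g i (σZ i))
        ≤ (∑ i, g i (F₂ i)) + (∑ i, g i (F₃ i)) + ∑ i, g i (T i) := by rw [sC, sE, sZ]; omega
    have := (FourBit.four_factors_eq ok w g hBC hCE hEZ hB hC hE hZ hP' hhi4 hs34 hs234).2.2.2
    exact hT0 (by rw [this]; exact hZ0)
  have hP' : ∀ i, List.Perm [M₂ i, M₃ i, M₄ i, T i] [σB i, σC i, σE i, σZ i] := fun i => perm4_rot (hP i)
  rcases x3 with ⟨m23, m33, m43⟩ | ⟨m23, m33, m43⟩ | ⟨m23, m33, m43⟩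
  · -- `M₂` carries `b3`; `M₃, M₄` are the candidates for the low factor
    have e8 := eight_le_slope g b hb hoff hmark haux M₂ m23
    rcases two_low m33 n34 m43 n44 (fun h => x0.2 h) with h3 | h4
    · exact key (fun i => perm4_rot (perm4_swap23 (perm4_swap12 (hP i)))) h3 e8 (by linarith)
    · exact key (fun i => perm4_rot (perm4_swap12 (perm4_swap23 (perm4_swap12 (hP i))))) h4 e8 (by linarith)
  · have e8 := eight_le_slope g b hb hoff hmark haux M₃ m33
    rcases two_low m23 n24 m43 n44 (fun h => (x0.1 h).2) with h2 | h4
    · exact key (fun i => perm4_rot (perm4_swap23 (hP i))) h2 e8 (by linarith)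
    · exact key (fun i => perm4_rot (perm4_swap12 (perm4_swap23 (hP i)))) h4 e8 (by linarith)
  · have e8 := eight_le_slope g b hb hoff hmark haux M₄ m43
    rcases two_low m23 n24 m33 n34 (fun h => (x0.1 h).1) with h2 | h3
    · exact key hP' h2 e8 (by linarith)
    · exact key (fun i => perm4_rot (perm4_swap12 (hP i))) h3 e8 (by linarith)

end Core

end Core
end MarkedEdge
end Summit.ValiantsHypothesis.ValiantsHypothesis.Theorems.KPlusLogSqLaw
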